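import Literature.AlgebraicGeometry.GroupSchemes.StrictBirationalGroupLaw
import Literature.AlgebraicGeometry.NeronModels.GroupObjectOfShearIso
import Literature.NumberTheory.EllipticCurves.NeronModelWeilFibre
import HarnessLib

/-!
# Fibres of `pr₁ : G ×_S G → G` meet `pr₂⁻¹(U)` densely for `U` fibrewise dense; the group-chunk solution of an
# everywhere-defined enlargement (Weil's theorem, stub W1d second half `GroupChunkOfGluing`)
# — [EdixhovenRomagny, Thm. 3.18 (ii)–(iii)] [Artin1986NeronModels, §2 Lemma 2.5] [BLRNeronModels1990, §5.1]

Topic `Literature/AlgebraicGeometry/GroupSchemes`; THEOREMS ONLY (no definition / named fact / instance); net Literature debt 0.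
Cell `hodgecm-mathlib` (D-0151), road W, node (W1), A-p06's sub-line text `GroupChunkOfGluing` (W1HeadProbe v4): the
everywhere-defined enlargement `(𝒢, i, m)` produced by the gluing (W1c) is a group scheme (★ `exists_grpObj_of_isIso_shear`,
the point coming from a section of `𝒳`) and `(𝒢, i)` is a group-chunk solution of `L`; the one non-formal field is
`surjective_div` — every point `g` of `𝒢` is `i(a) i(b)⁻¹` for points `a, b` of `𝒳` with values in one field — which is
§1: in the fibre `pr₁⁻¹(g) ⊆ 𝒢 ×_S 𝒢` the open `pr₂⁻¹(i𝒳)` is DENSE (the projection of `pr₁⁻¹(g) = 𝒢_t ⊗_{κ(t)} κ(g)` to the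
irreducible fibre `𝒢_t` is flat, hence generizing, so generic points of components of `pr₁⁻¹(g)` map to the generic point
of `𝒢_t`, which lies in `i𝒳`), so it meets the non-empty open `μ⁻¹(i𝒳) ∩ pr₁⁻¹(g)`; a common point `w = (g, y)` has
`y ∈ i𝒳` and `g y ∈ i𝒳`, i.e. `g = (g y) y⁻¹`.
HC_CM is proved only modulo the 7 printed citations until rung 0 closes.
-/

noncomputable section

universe u

namespace Literature.AlgebraicGeometry.GroupSchemes

open CategoryTheory CategoryTheory.Limits _root_.AlgebraicGeometry MonoidalCategory CartesianMonoidalCategory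
open MonObj GrpObj Literature.AlgebraicGeometry.NeronModels Literature.NumberTheory.EllipticCurves
open scoped CategoryTheory.Obj

/-! ### §1 `pr₂⁻¹(U)` is dense in every fibre of `pr₁` -/

section FibreDensity

variable {S : Scheme.{u}} (𝒢 : Over S)

/-- **In the fibre `pr₁⁻¹(g) ⊆ 𝒢 ×_S 𝒢` the open `pr₂⁻¹(U)` is dense, for `U` open and dense in every fibre of `𝒢 → S` and
the fibres of `𝒢 → S` irreducible**: if an open `W ⊆ 𝒢 ×_S 𝒢` has a point over `g` (for `pr₁`), it has one over `g` whose
second coordinate lies in `U`.  Proof: the projection `ρ : pr₁⁻¹(g) → 𝒢_t` (`t` the base point of `g`) is a base change of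
`Spec κ(g) → Spec κ(t)`, hence flat and generizing; the generic point `γ` of the irreducible component of `pr₁⁻¹(g)` through
the given point lies in `W` and `ρ(γ)` is a maximal point of the irreducible fibre `𝒢_t`, i.e. its generic point, which
lies in the non-empty open `U ∩ 𝒢_t`. [cite: EdixhovenRomagny, Thm. 3.18 (iii)] [cite: StacksProject, Tag 03HV] -/
theorem exists_mem_fibre_fst_snd_mem (hirr : ∀ s : S, IsPreirreducible (𝒢.hom.base ⁻¹' {s}))
    (U : Set 𝒢.left) (hUo : IsOpen U) (hU : IsFibrewiseDense 𝒢.hom U) (g : 𝒢.left)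
    (W : (𝒢 ⊗ 𝒢).left.Opens) (hW : ∃ w₀ ∈ (W : Set (𝒢 ⊗ 𝒢).left), (fst 𝒢 𝒢).left.base w₀ = g) :
    ∃ w ∈ (W : Set (𝒢 ⊗ 𝒢).left), (fst 𝒢 𝒢).left.base w = g ∧ (snd 𝒢 𝒢).left.base w ∈ U := by
  -- notation
  let X : Scheme.{u} := 𝒢.left
  let f : X ⟶ S := 𝒢.hom
  let Z : Scheme.{u} := (𝒢 ⊗ 𝒢).left
  let pr₁ : Z ⟶ X := (fst 𝒢 𝒢).left
  let pr₂ : Z ⟶ X := (snd 𝒢 𝒢).left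
  have hpr : pr₁ ≫ f = pr₂ ≫ f := (Over.w (fst 𝒢 𝒢)).trans (Over.w (snd 𝒢 𝒢)).symm
  obtain ⟨w₀, hw₀W, hw₀⟩ := hW
  -- the fibre `P = pr₁⁻¹(g)` and its flat projection `ρ` to the fibre `X_t`, `t = f g`
  have hsq := isPullback_fiberToSpecResidueField_of_isPullback
    (fst := pr₂) (snd := pr₁) (f := f) (g := f) (IsPullback.of_hasPullback 𝒢.hom 𝒢.hom).flip g
  let ρ : pr₁.fiber g ⟶ f.fiber (f.base g) :=
    pullback.map pr₁ (X.fromSpecResidueField g) f (S.fromSpecResidueField (f.base g))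
      pr₂ (Spec.map (f.residueFieldMap g)) f hpr (by simp)
  have hρι : ρ ≫ f.fiberι (f.base g) = pr₁.fiberι g ≫ pr₂ := pullback.lift_fst _ _ _
  haveI hflatb : Flat (Spec.map (f.residueFieldMap g)) := by
    rw [HasRingHomProperty.Spec_iff (P := @Flat)]
    letI := (f.residueFieldMap g).hom.toAlgebra
    change Module.Flat _ _
    infer_instance
  haveI : Flat ρ := MorphismProperty.of_isPullback hsq.flip hflatb
  -- the point `p₀` of `P` over `w₀`, and the generic point `γ` of its component; `γ ∈ W`
  obtain ⟨p₀, hp₀⟩ : w₀ ∈ Set.range (pr₁.fiberι g).base := by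
    rw [Scheme.Hom.range_fiberι]
    exact hw₀
  have hC := irreducibleComponent_mem_irreducibleComponents p₀
  let γ : pr₁.fiber g := (isIrreducible_irreducibleComponent (x := p₀)).genericPoint
  have hγ : IsGenericPoint γ (irreducibleComponent p₀) :=
    (isIrreducible_irreducibleComponent (x := p₀)).isGenericPoint_genericPoint isClosed_irreducibleComponent
  have hγp₀ : γ ⤳ p₀ := hγ.specializes mem_irreducibleComponent
  have hγW : (pr₁.fiberι g).base γ ∈ W := by
    have h1 : (pr₁.fiberι g).base γ ⤳ (pr₁.fiberι g).base p₀ := hγp₀.map (pr₁.fiberι g).base.hom.continuous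
    rw [hp₀] at h1
    exact h1.mem_open W.2 hw₀W
  -- `y = pr₂ (γ)`, a maximal point of the fibre `X_t`
  let w : Z := (pr₁.fiberι g).base γ
  have hw₁ : pr₁.base w = g := by
    have : w ∈ Set.range (pr₁.fiberι g).base := ⟨γ, rfl⟩
    rw [Scheme.Hom.range_fiberι] at this
    exact this
  let y : X := pr₂.base w
  have hy_eq : y = (f.fiberι (f.base g)).base (ρ.base γ) := (congrArg (fun k => k.base γ) hρι).symm
  have hfy : f.base y = f.base g := by
    change (pr₂ ≫ f).base w = f.base g
    rw [← hpr]
    change f.base (pr₁.base w) = f.base g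
    rw [hw₁]
  have hmax : ∀ y' : X, y' ⤳ y → f.base y' = f.base g → y' = y := by
    intro y' hy'y hfy'
    obtain ⟨m', hm'⟩ : y' ∈ Set.range (f.fiberι (f.base g)).base := by
      rw [Scheme.Hom.range_fiberι]
      exact hfy'
    have hsp : m' ⤳ ρ.base γ := by
      rw [← (f.fiberι (f.base g)).isEmbedding.isInducing.specializes_iff, hm', ← hy_eq]
      exact hy'y
    obtain ⟨γ', hγ'γ, hργ'⟩ := Flat.generalizingMap ρ hsp
    have hγ' : γ' = γ := eq_of_specializes_of_isGenericPoint hC hγ hγ'γ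
    rw [← hm', ← hργ', hγ', ← hy_eq]
  -- the fibre `X_t` is irreducible with a point `u ∈ U`; its generic point is `y`, so `y ∈ U`
  obtain ⟨u, huU, hu⟩ := hU.nonempty_inter_fibre (x := f.base g) ⟨g, rfl⟩
  have hZirr : IsPreirreducible (f.base ⁻¹' {f.base g}) := hirr (f.base g)
  -- the generic point `ζ` of the closure of the fibre lies in the fibre and generizes `u` and `y`
  let T : Set X := f.base ⁻¹' {f.base g}
  have hTirr : IsIrreducible T := ⟨⟨g, rfl⟩, hZirr⟩
  obtain ⟨ζ, hζ⟩ := QuasiSober.sober hTirr.closure isClosed_closure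
  have hζu : ζ ⤳ u := hζ.specializes (subset_closure hu)
  have hζy : ζ ⤳ y := hζ.specializes (subset_closure hfy)
  have hζT : f.base ζ = f.base g := by
    -- `f ζ ⤳ f u = f g` and `ζ ∈ closure T ⊆ f⁻¹(closure {f g})`, i.e. `f g ⤳ f ζ`
    have h1 : f.base ζ ⤳ f.base g := by rw [← hu]; exact hζu.map f.base.hom.continuous
    have h2 : f.base g ⤳ f.base ζ := by
      have : ζ ∈ f.base ⁻¹' closure {f.base g} :=
        (closure_minimal (Set.preimage_mono subset_closure) (isClosed_closure.preimage f.base.hom.continuous)) hζ.mem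
      exact specializes_iff_mem_closure.mpr this
    exact (h1.antisymm h2).eq
  have hyζ : ζ = y := hmax ζ hζy hζT
  refine ⟨w, hγW, hw₁, ?_⟩
  change y ∈ U
  rw [← hyζ]
  exact hζu.mem_open hUo huU

end FibreDensity

/-! ### §2 The group-chunk solution of an everywhere-defined enlargement -/

section Solution

variable {S : Scheme.{u}} {𝒳 : Over S}

/-- Irreducibility of the fibres passes from `𝒳` to an enlargement `𝒢 ⊇ i(𝒳)` in which `i(𝒳)` is dense in every fibre
(a set squeezed between a preirreducible set and its closure is preirreducible). [cite: EdixhovenRomagny, Thm. 3.18 (ii)] -/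
theorem isPreirreducible_fibre_of_isFibrewiseDense {𝒢 : Over S} (i : 𝒳 ⟶ 𝒢)
    (hirr : ∀ s : S, IsPreirreducible (𝒳.hom.base ⁻¹' {s}))
    (hd : IsFibrewiseDense 𝒢.hom (Set.range i.left.base)) (s : S) : IsPreirreducible (𝒢.hom.base ⁻¹' {s}) := by
  -- `i(𝒳_s) = i(𝒳) ∩ 𝒢_s` is preirreducible and `𝒢_s` lies in its closure
  have himg : i.left.base '' (𝒳.hom.base ⁻¹' {s}) = Set.range i.left.base ∩ 𝒢.hom.base ⁻¹' {s} := by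
    ext z
    constructor
    · rintro ⟨x, hx, rfl⟩
      refine ⟨⟨x, rfl⟩, ?_⟩
      change (i.left ≫ 𝒢.hom).base x ∈ ({s} : Set S)
      rw [Over.w i]
      exact hx
    · rintro ⟨⟨x, rfl⟩, hz⟩
      refine ⟨x, ?_, rfl⟩
      change 𝒳.hom.base x ∈ ({s} : Set S)
      rw [← Over.w i]
      exact hz
  have hA : IsPreirreducible (Set.range i.left.base ∩ 𝒢.hom.base ⁻¹' {s}) := by
    rw [← himg]
    exact (hirr s).image _ i.left.base.hom.continuous.continuousOn
  have hsub : Set.range i.left.base ∩ 𝒢.hom.base ⁻¹' {s} ⊆ 𝒢.hom.base ⁻¹' {s} := Set.inter_subset_right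
  have hcl : closure (𝒢.hom.base ⁻¹' {s}) = closure (Set.range i.left.base ∩ 𝒢.hom.base ⁻¹' {s}) :=
    (closure_mono hsub).antisymm' (closure_minimal (hd s) isClosed_closure)
  rw [← isPreirreducible_iff_closure, hcl, isPreirreducible_iff_closure]
  exact hA

/-- **Stub W1d, second half (`GroupChunkOfGluing`, A-p06's sub-line text): the everywhere-defined enlargement is a
group-chunk solution.**  Let `L` be a birational group law on `𝒳 → S` (`𝒳` with irreducible fibres and a section),
`i : 𝒳 ⟶ 𝒢` an open immersion over `S` with fibrewise-dense image, and `m : 𝒢 ⊗ 𝒢 ⟶ 𝒢` an everywhere-defined law,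
associative on `T`-points, whose two shear maps are isomorphisms and which extends `L.mul`.  Then `𝒢` is a group
scheme with multiplication `m` (★ `exists_grpObj_of_isIso_shear`, the point being the section pushed into `𝒢`) and
`(𝒢, i)` is a group-chunk solution of `L`: `j(ab) = j(a) j(b)` is the hypothesis, and EVERY POINT `g` of `𝒢` is
`i(a) i(b)⁻¹` for points `a, b` of `𝒳` with values in the residue field of a point `w = (g, y)` of `𝒢 ×_S 𝒢` with
`y, g y ∈ i(𝒳)` — such `w` exists because `pr₂⁻¹(i𝒳)` is dense in the fibre `pr₁⁻¹(g)`
(`exists_mem_fibre_fst_snd_mem`) and `m⁻¹(i𝒳)` meets it (through the shear isomorphism).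
[cite: EdixhovenRomagny, Thm. 3.18 (ii)-(iii)] [cite: Artin1986NeronModels, §2 Lemma 2.5 p. 223] -/
theorem groupChunkOfGluing (hsec : ∃ a : S ⟶ 𝒳.left, a ≫ 𝒳.hom = 𝟙 S)
    (hirr : ∀ s : S, IsPreirreducible (𝒳.hom.base ⁻¹' {s})) (L : BirationalGroupLaw 𝒳)
    (𝒢 : Over S) (i : 𝒳 ⟶ 𝒢) (m : 𝒢 ⊗ 𝒢 ⟶ 𝒢) (hi : IsOpenImmersion i.left)
    (hd : IsFibrewiseDense 𝒢.hom (Set.range i.left.base))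
    (hassoc : ∀ {T : Over S} (a b c : T ⟶ 𝒢), lift (lift a b ≫ m) c ≫ m = lift a (lift b c ≫ m) ≫ m)
    (hΦ : IsIso (lift (fst 𝒢 𝒢) m)) (hΨ : IsIso (lift m (snd 𝒢 𝒢)))
    (hcomp : L.mul ≫ i.left = L.dom.ι ≫ (i ⊗ₘ i).left ≫ m.left) :
    ∃ (_ : GrpObj 𝒢) (j : 𝒳 ⟶ 𝒢), j = i ∧ IsGroupChunkSolution L 𝒢 j := by
  haveI := hi
  -- the point of `𝒢` and the group structure
  obtain ⟨a₀, ha₀⟩ := hsec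
  let e : 𝟙_ (Over S) ⟶ 𝒢 := Over.homMk (a₀ ≫ i.left) (by
    change (a₀ ≫ i.left) ≫ 𝒢.hom = 𝟙 S
    rw [Category.assoc, Over.w i, ha₀])
  haveI := hΦ
  haveI := hΨ
  obtain ⟨inst, hmul⟩ := exists_grpObj_of_isIso_shear m hassoc e
  refine ⟨inst, i, rfl, ⟨hi, hd, ?_, ?_⟩⟩
  · rw [hcomp, hmul]
  -- `surjective_div`
  intro g
  -- notation
  let U : Set 𝒢.left := Set.range i.left.base
  have hUo : IsOpen U := i.left.isOpenEmbedding.isOpen_range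
  let pr₁ : (𝒢 ⊗ 𝒢).left ⟶ 𝒢.left := (fst 𝒢 𝒢).left
  let pr₂ : (𝒢 ⊗ 𝒢).left ⟶ 𝒢.left := (snd 𝒢 𝒢).left
  have hirrG : ∀ s : S, IsPreirreducible (𝒢.hom.base ⁻¹' {s}) := isPreirreducible_fibre_of_isFibrewiseDense i hirr hd
  -- (1) a point `z = (g, y)` with `y ∈ U` (density in the fibre, starting from the diagonal point)
  obtain ⟨z, -, hz₁, hz₂⟩ := exists_mem_fibre_fst_snd_mem 𝒢 hirrG U hUo hd g ⊤
    ⟨(lift (𝟙 𝒢) (𝟙 𝒢)).left.base g, trivial, by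
      change ((lift (𝟙 𝒢) (𝟙 𝒢)) ≫ fst 𝒢 𝒢).left.base g = g
      rw [lift_fst]
      rfl⟩
  -- (2) through the shear `Φ = (pr₁, m)`: the point `w₀ := Φ⁻¹ z` lies over `g` with `m w₀ = y ∈ U`
  let Φ : 𝒢 ⊗ 𝒢 ⟶ 𝒢 ⊗ 𝒢 := lift (fst 𝒢 𝒢) m
  have hΦ₁ : inv Φ ≫ fst 𝒢 𝒢 = fst 𝒢 𝒢 := by
    conv_rhs => rw [← Category.id_comp (fst 𝒢 𝒢), ← IsIso.inv_hom_id Φ, Category.assoc, lift_fst]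
  have hΦ₂ : inv Φ ≫ m = snd 𝒢 𝒢 := by
    conv_rhs => rw [← Category.id_comp (snd 𝒢 𝒢), ← IsIso.inv_hom_id Φ, Category.assoc, lift_snd]
  let W : (𝒢 ⊗ 𝒢).left.Opens := m.left ⁻¹ᵁ ⟨U, hUo⟩
  have hW : ∃ w₀ ∈ (W : Set (𝒢 ⊗ 𝒢).left), pr₁.base w₀ = g := by
    refine ⟨(inv Φ).left.base z, ?_, ?_⟩
    · change m.left.base ((inv Φ).left.base z) ∈ U
      rw [← Scheme.Hom.comp_apply, ← Over.comp_left, hΦ₂]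
      exact hz₂
    · change (fst 𝒢 𝒢).left.base ((inv Φ).left.base z) = g
      rw [← Scheme.Hom.comp_apply, ← Over.comp_left, hΦ₁]
      exact hz₁
  -- (3) density again: a point `w = (g, y)` of `W` with `y ∈ U`, i.e. `y ∈ i𝒳` and `g y ∈ i𝒳`
  obtain ⟨w, hwW, hw₁, hw₂⟩ := exists_mem_fibre_fst_snd_mem 𝒢 hirrG U hUo hd g W hW
  have hw₃ : m.left.base w ∈ U := hwW
  -- (4) the `κ(w)`-points: `x₁ = g`, `x₂ = y = i(b)`, `x₁ x₂ = g y = i(a)`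
  let ω : Spec ((𝒢 ⊗ 𝒢).left.residueField w) ⟶ (𝒢 ⊗ 𝒢).left := (𝒢 ⊗ 𝒢).left.fromSpecResidueField w
  let T : Over S := Over.mk (ω ≫ (𝒢 ⊗ 𝒢).hom)
  let ω' : T ⟶ 𝒢 ⊗ 𝒢 := Over.homMk ω rfl
  have hωw : ∀ t : Spec ((𝒢 ⊗ 𝒢).left.residueField w), ω.base t = w := fun t => by
    rw [show t = IsLocalRing.closedPoint _ from Subsingleton.elim _ _]
    exact Scheme.fromSpecResidueField_apply _ _
  obtain ⟨b₀, hb₀⟩ : ∃ b₀ : T.left ⟶ 𝒳.left, b₀ ≫ i.left = ω ≫ pr₂ :=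
    ⟨IsOpenImmersion.lift i.left (ω ≫ pr₂) (by
        rintro _ ⟨t, rfl⟩
        change pr₂.base (ω.base t) ∈ U
        rw [hωw]
        exact hw₂),
      IsOpenImmersion.lift_fac _ _ _⟩
  obtain ⟨a₁, ha₁⟩ : ∃ a₁ : T.left ⟶ 𝒳.left, a₁ ≫ i.left = ω ≫ m.left :=
    ⟨IsOpenImmersion.lift i.left (ω ≫ m.left) (by
        rintro _ ⟨t, rfl⟩
        change m.left.base (ω.base t) ∈ U
        rw [hωw]
        exact hw₃),
      IsOpenImmersion.lift_fac _ _ _⟩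
  have e0 : i.left ≫ 𝒢.hom = 𝒳.hom := Over.w i
  have e1 : pr₂ ≫ 𝒢.hom = (𝒢 ⊗ 𝒢).hom := Over.w (snd 𝒢 𝒢)
  have e2 : m.left ≫ 𝒢.hom = (𝒢 ⊗ 𝒢).hom := Over.w m
  let b : T ⟶ 𝒳 := Over.homMk b₀ (by
    change b₀ ≫ 𝒳.hom = ω ≫ (𝒢 ⊗ 𝒢).hom
    rw [← e0, ← e1, ← Category.assoc, ← Category.assoc, hb₀]
    rfl)
  let a : T ⟶ 𝒳 := Over.homMk a₁ (by
    change a₁ ≫ 𝒳.hom = ω ≫ (𝒢 ⊗ 𝒢).hom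
    rw [← e0, ← e2, ← Category.assoc, ← Category.assoc, ha₁]
    rfl)
  have hbi : b ≫ i = ω' ≫ snd 𝒢 𝒢 := (Over.forget S).map_injective hb₀
  have hai : a ≫ i = ω' ≫ m := (Over.forget S).map_injective ha₁
  -- (5) `d (a, b) = i(a) i(b)⁻¹ = (x₁ x₂) x₂⁻¹ = x₁`
  have hkey : lift a b ≫ ((i ⊗ₘ i) ≫ (𝒢 ◁ ι[𝒢]) ≫ μ[𝒢]) = ω' ≫ fst 𝒢 𝒢 := by
    have h1 : lift a b ≫ ((i ⊗ₘ i) ≫ (𝒢 ◁ ι[𝒢]) ≫ μ[𝒢]) = (a ≫ i) * (b ≫ i)⁻¹ := by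
      rw [Hom.inv_def, Hom.mul_def, lift_map_assoc, lift_whiskerLeft_assoc]
    have h2 : ω' ≫ m = (ω' ≫ fst 𝒢 𝒢) * (ω' ≫ snd 𝒢 𝒢) := by
      rw [Hom.mul_def, hmul, ← comp_lift, lift_fst_snd, Category.comp_id]
    rw [h1, hai, hbi, h2, mul_inv_cancel_right]
  refine ⟨(lift a b).left.base (IsLocalRing.closedPoint _), ?_⟩
  rw [← Scheme.Hom.comp_apply, ← Over.comp_left, hkey, Over.comp_left, Scheme.Hom.comp_apply]
  change pr₁.base (ω.base (IsLocalRing.closedPoint _)) = g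
  rw [Scheme.fromSpecResidueField_apply]
  exact hw₁

end Solution

end Literature.AlgebraicGeometry.GroupSchemes

end
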